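import Summits.QuantumAdvantage.QuantumAdvantage.Theses.CompactnessLift
import Literature.Computability.Complexity.RelativizedTime
import Literature.Computability.QuantumComplexity.BQTime
import Literature.Barriers.QuantumAdvantage.SeparationPrerequisites

/-!
# Ideator-2 negative notes for the crux `LanguageLadder` (stmt-QuantumAdvantage-15271) — kernel-checked part (companion of `Ideator2-NegativeNotes.md`)

Claim formalised here (pure logic over the tree's `BQTime` / `BPTime` / `BQP` / `BPP`, every folklore
Turing-machine construction NAMED as an explicit hypothesis, nothing smuggled):

**Every CONSTRUCTIVE line on the (repaired) ladder is a line on the summit.**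
A proof of `∀ c, ∃ L ∈ BQTIME(n²), L ∉ BPTIME(n^c)` that exhibits the rung witnesses by ONE explicit
construction `c ↦ F_c` (as every explicit "take padded problem P_c" strategy does) yields a
*computably witnessed ladder*: the clocked universal simulation along the construction is a single
quadratic-uniform gapped family `U` from which every rung language pulls back along a linear-stretch,
linear-time map. Then `U ∉ BPTIME(n^d)` for every `d` (below, `ladderSwap_of_cwl`, UNCONDITIONAL), i.e.
the census's quantifier-swapped form `LadderSwap`, which is the summit modulo coin splitting
(`summit_of_cwl`). Conversely the summit gives a computably witnessed ladder modulo quadratic padding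
(`cwl_of_summit`). So `ComputablyWitnessedLadder ⟺ QuantumAdvantage` (mod folklore), and the only part of
the repaired crux that is weaker than the summit is reachable ONLY by a non-constructive (Kannan-style)
selection of rung witnesses — for which the natural case split (on `BQP ⊆ BPP`) is circular
(`nonconstructive_split_is_circular`).
-/

namespace Summit.QuantumAdvantage.QuantumAdvantage.Cruxes.LanguageLadder.Ideator2

open _root_.Computability Literature.Computability.Complexity Literature.Computability.Complexity.Classes
  Literature.Computability.QuantumComplexity Literature.Computability.Cryptography
open Literature.Barriers.QuantumAdvantage
open Summit.QuantumAdvantage.QuantumAdvantage.Theses.CompactnessLift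

set_option linter.dupNamespace false

/-- The refuter's repaired crux (verbatim from `CruxAttack15271.lean` / `Census.LanguageLadderR`). -/
def LanguageLadderR : Prop :=
  ∀ c : ℕ, ∃ L ∈ BQTime (fun n => n ^ 2), L ∉ BPTime (fun n => n ^ c)

/-- Census `S⁺₁`: ONE quadratic quantum language outside every `BPTIME(n^c)`. -/
def LadderSwap : Prop :=
  ∃ L ∈ BQTime (fun n => n ^ 2), ∀ c : ℕ, L ∉ BPTime (fun n => n ^ c)

/-- **Coin splitting** `BPP ⊆ ⋃ c, BPTIME(n^c)` (folklore TM construction, NOT in the tree —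
`RelativizedTime.lean`, "Not here"). Explicit hypothesis. -/
def BPPCovered : Prop :=
  BPP ⊆ ⋃ c : ℕ, BPTime (fun n => n ^ c)

/-- **Quadratic padding** (folklore, NOT in the tree; the repaired `SummitGivesLadder`). Explicit hypothesis. -/
def QuadPadding : Prop :=
  _root_.QuantumAdvantage → ∃ L ∈ BQTime (fun n => n ^ 2), L ∉ BPP

/-- `U` is a **universal language** for the sequence `L`: `U` is quadratic-uniform quantum, and every
`L c` pulls back from `U` along a map that `BPTIME(n^d)` machines absorb with the SAME exponent `d`
(a linear-time, linear-stretch many-one reduction `x ↦ ⟨c, x, 0^{K_c |x|}⟩` does this; the closure of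
`BPTime (· ^ d)` under such maps is a folklore TM construction, so it is recorded here as the conclusion
actually needed rather than assumed globally). -/
def UniversalFor (L : ℕ → Language Bool) (U : Language Bool) : Prop :=
  U ∈ BQTime (fun n => n ^ 2) ∧
    ∀ c d : ℕ, U ∈ BPTime (fun n => n ^ d) → L c ∈ BPTime (fun n => n ^ d)

/-- **Computably witnessed ladder (CWL)**: one sequence of rung witnesses that admits a universal
language. Every explicit construction `c ↦ F_c` of quadratic-uniform gapped Clifford+T families has
one — the clocked universal simulation
`U_F = {⟨c, x, pad⟩ : the selector halts on c within |input| steps ∧ the encoder of F_c halts on 1^{|x|}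
within |input|² steps ∧ F_c accepts x}` is gapped on ALL inputs (trivial rejecting circuit or F_c's own
gapped circuit), quadratic-uniform (two clocked simulations), and receives each `Lang(F_c)` by a
linear-stretch padding map (route item T1 / Schöning–Ladner / Hartmanis–Hemachandra "recursive
presentation ⇒ complete language"; XL as a TM2 construction, not attempted here). -/
def ComputablyWitnessedLadder : Prop :=
  ∃ L : ℕ → Language Bool,
    (∀ c, L c ∈ BQTime (fun n => n ^ 2)) ∧ (∃ U, UniversalFor L U) ∧ ∀ c, L c ∉ BPTime (fun n => n ^ c)

/-- CWL trivially gives the repaired crux … -/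
theorem languageLadderR_of_cwl (h : ComputablyWitnessedLadder) : LanguageLadderR := by
  obtain ⟨L, hq, -, hhard⟩ := h
  exact fun c => ⟨L c, hq c, hhard c⟩

/-- … but it already gives the QUANTIFIER SWAP, unconditionally: the universal language is outside every
`BPTIME(n^d)`. This is the whole point: an explicit family of rung witnesses collapses to ONE witness. -/
theorem ladderSwap_of_cwl (h : ComputablyWitnessedLadder) : LadderSwap := by
  obtain ⟨L, -, ⟨U, hUq, hpull⟩, hhard⟩ := h
  exact ⟨U, hUq, fun d hUd => hhard d (hpull d d hUd)⟩

/-- Hence CWL proves the summit (modulo coin splitting only). -/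
theorem summit_of_cwl (hcov : BPPCovered) (h : ComputablyWitnessedLadder) : _root_.QuantumAdvantage := by
  obtain ⟨U, hUq, hU⟩ := ladderSwap_of_cwl h
  refine ⟨U, BQTime_pow_subset_BQP 2 hUq, fun hB => ?_⟩
  obtain ⟨d, hd⟩ := Set.mem_iUnion.1 (hcov hB)
  exact hU d hd

/-- Conversely the summit gives a computably witnessed ladder (modulo quadratic padding): the constant
sequence at the padded witness, which is its own universal language. So CWL ⟺ S modulo folklore. -/
theorem cwl_of_summit (hpad : QuadPadding) (hS : _root_.QuantumAdvantage) : ComputablyWitnessedLadder := by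
  obtain ⟨L, hLq, hLB⟩ := hpad hS
  refine ⟨fun _ => L, fun _ => hLq, ⟨L, hLq, fun _ d hd => hd⟩, fun c hc => hLB (BPTime_pow_subset_BPP c hc)⟩

/-- The gap `LanguageLadderR ∖ QuantumAdvantage` is therefore NON-CONSTRUCTIVE territory: it needs rung
witnesses with no universal language, i.e. a selection `c ↦ L_c` that no explicit construction performs.
The natural Kannan-style case split is on the summit itself, and it is circular: the `¬S` branch
"`BQP ⊆ BPP` ⇒ no uniform exponent" is *equivalent* to the crux (pure logic, below), so the split makes
no progress. (`NoUniformExponentIfCollapse` = the negation of the route's other crux CP′ restricted to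
the collapse world.) -/
def NoUniformExponentIfCollapse : Prop :=
  BQP ⊆ BPP → LanguageLadderR

theorem nonconstructive_split_is_circular (hpad : QuadPadding) :
    NoUniformExponentIfCollapse ↔ LanguageLadderR := by
  constructor
  · intro h c
    by_cases hsub : BQP ⊆ BPP
    · exact h hsub c
    · -- the `S` branch: a BQP language outside BPP pads into the quadratic window and beats every rung
      have hS : _root_.QuantumAdvantage := by
        by_contra hS
        exact hsub fun L hL => by_contra fun hLB => hS ⟨L, hL, hLB⟩
      obtain ⟨L, hLq, hLB⟩ := hpad hS
      exact ⟨L, hLq, fun hc => hLB (BPTime_pow_subset_BPP c hc)⟩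
  · exact fun h _ => h

/-- For the record, against the REAL route decl: the crux AS TYPED implies CWL outright modulo the
padding collapse `BPP ⊆ bp (DTIME n^{c₀})` (it is the summit in the quadratic window, census §0), so for
the typed crux even the non-constructive escape hatch is closed. -/
def PaddingCollapse (c₀ : ℕ) : Prop :=
  BPP ⊆ bp (DTIME fun n => n ^ c₀)

theorem cwl_of_languageLadder {c₀ : ℕ} (hcol : PaddingCollapse c₀) (h : LanguageLadder) :
    ComputablyWitnessedLadder := by
  obtain ⟨L, hLq, hLc⟩ := h c₀
  have hLq' : L ∈ BQTime (fun n => n ^ 2) := hLq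
  have hLB : L ∉ BPP := fun hB => hLc (hcol hB)
  exact ⟨fun _ => L, fun _ => hLq', ⟨L, hLq', fun _ d hd => hd⟩,
    fun c hc => hLB (BPTime_pow_subset_BPP c hc)⟩

/-! ## B0 · The repaired crux keeps the summit's separation floor (QA-A03 for `LanguageLadderR`)

`LanguageLadderR` is formally WEAKER than the summit (`S → LL′`, census §1), but it still implies
`PP ⊄ BPP` (hence `P ≠ PP`, `P ≠ PSPACE`): `PP` is a syntactic class with a complete language, so a
collapse `PP ⊆ BPP` dequantizes `BQTIME(n²)` with a UNIFORM exponent — exactly a counterexample to the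
ladder. The one folklore ingredient is named below (`PPHardForQuad`: fine-grained
Adleman–DeMarrais–Huang path sums put `BQTIME(n²)` inside unbounded-error probabilistic TIME(n^a);
Cook–Levin reduces that to `MajSAT ∈ PP` with stretch `Õ(n^a)`; `BPTIME(n^k)` pulls back along a
`DTIME(n^a)` stretch-`n^a` map to `BPTIME(n^{ak+a})`). So any proof of the repaired crux is a proof of
`P ≠ PSPACE` — the crux is A03-hard on its own, not merely "implied by S". -/

/-- **`PP` is fine-grained hard for quadratic quantum time** (folklore, NOT in the tree): some `K ∈ PP`
(MajSAT) and an absolute `a` such that `K ∈ BPTIME(n^k)` dequantizes all of `BQTIME(n²)` into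
`BPTIME(n^{a k + a})`. Explicit hypothesis. -/
def PPHardForQuad : Prop :=
  ∃ K ∈ PP, ∃ a : ℕ, ∀ k : ℕ, K ∈ BPTime (fun n => n ^ k) →
    BQTime (fun n => n ^ 2) ⊆ BPTime (fun n => n ^ (a * k + a))

/-- `PP ⊆ BPP` refutes the repaired ladder (modulo coin splitting and `PPHardForQuad`): the collapse of a
SYNTACTIC class comes with a uniform exponent. -/
theorem not_languageLadderR_of_PP_subset_BPP (hcov : BPPCovered) (hK : PPHardForQuad)
    (hsub : PP ⊆ BPP) : ¬ LanguageLadderR := by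
  intro h
  obtain ⟨K, hKPP, a, hK⟩ := hK
  obtain ⟨k, hk⟩ := Set.mem_iUnion.1 (hcov (hsub hKPP))
  obtain ⟨L, hL, hLno⟩ := h (a * k + a)
  exact hLno (hK k hk hL)

/-- **The A03 floor for the repaired crux**: `LanguageLadderR → PP ⊄ BPP`. -/
theorem not_PP_subset_BPP_of_languageLadderR (hcov : BPPCovered) (hK : PPHardForQuad)
    (h : LanguageLadderR) : ¬ PP ⊆ BPP :=
  fun hsub => not_languageLadderR_of_PP_subset_BPP hcov hK hsub h

/-- … hence `P ≠ PP` … -/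
theorem P_ne_PP_of_languageLadderR (hcov : BPPCovered) (hK : PPHardForQuad)
    (h : LanguageLadderR) : P ≠ PP := by
  intro hP
  exact not_PP_subset_BPP_of_languageLadderR hcov hK h (hP ▸ P_subset_BPP_holds)

/-- … and `P ≠ PSPACE` (given the tree's named fact `PP ⊆ PSPACE`). Any proof of the repaired crux is a
proof of `P ≠ PSPACE`. -/
theorem P_ne_PSPACE_of_languageLadderR (hcov : BPPCovered) (hK : PPHardForQuad)
    (hPS : PP_subset_PSPACE) (h : LanguageLadderR) : P ≠ PSPACE := by
  intro hP
  refine not_PP_subset_BPP_of_languageLadderR hcov hK h fun L hL => ?_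
  have hLP : L ∈ P := hP ▸ hPS hL
  exact P_subset_BPP_holds hLP

/-- The same floor for the crux AS TYPED needs nothing new: it implies the repaired one outright
(`BPTIME(n^c) ⊆ bp (DTIME n) ⊆ bp (DTIME n^{max c 1})`, census `languageLadderR_of_languageLadder`). -/
theorem languageLadderR_of_languageLadder (h : LanguageLadder) : LanguageLadderR := by
  intro c
  obtain ⟨L, hL, hno⟩ := h (max c 1)
  refine ⟨L, hL, fun hB => hno ?_⟩
  have h1 : BPTime (fun n => n ^ c) ⊆ bp (DTIME fun n => n) := bpTime_pow_subset_bp _ c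
  have h2 : bp (DTIME fun n => n) ⊆ bp (DTIME fun n => n ^ max c 1) :=
    bp_mono (DTIME_mono fun n => Nat.le_self_pow (by omega) n)
  exact h2 (h1 hB)

theorem P_ne_PSPACE_of_languageLadder (hcov : BPPCovered) (hK : PPHardForQuad)
    (hPS : PP_subset_PSPACE) (h : LanguageLadder) : P ≠ PSPACE :=
  P_ne_PSPACE_of_languageLadderR hcov hK hPS (languageLadderR_of_languageLadder h)

end Summit.QuantumAdvantage.QuantumAdvantage.Cruxes.LanguageLadder.Ideator2
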